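import Summits.QuantumFields.YangMills.Theorems.BalabanUVNodesN15CovariantLandauTwoGridGreen
import Summits.QuantumFields.YangMills.Theorems.BalabanUVNodesN15CovariantLandauLetterRows
import Summits.QuantumFields.YangMills.Theorems.BalabanUVNodesN15VectorPieceVWords
import HarnessLib

/-!
# Route «BalabanUVNodes», node N15 = NE2, road (c) — PROGRAMME (P-S), XXXI: THE TWO-GRID η-DEFECTS OF THE MINIMIZER `M = G′Q′ᵀ`, OF ITS COVARIANT GRADIENT `E = D_TG′Q′ᵀ`, AND OF
# THEIR TRANSPOSES (scaled unit-lattice transport `ν·id`, `ν = L^{m(d+1)}`; `𝔇(Mᵀ) = ν⁻¹·𝔇(M)ᵀ·P̂` exactly) (dag-n15-c g24, n15-c∕238; HOME HANDOFF «(G3)»)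

Cell `pub-ymgap`, seat `pub-ymgap-dag-n15-c` (generation g24; R134 (a), s1; HUMAN RULING D-0062; chair R424 venue).  `bears_on: R4∕N15 · K3⁸ SpineGivenEndpointR13SepCoPHV
(stmt-QuantumFields-27366)`; filed `--supports stmt-QuantumFields-27366 --as helper` — COUNT-NEUTRAL.  One definition (`pullMat`), theorems; 0 `sorry`.  Imports BY NAME n15-c∕212 (`cM`, `cE`),
214 (`hasMaj_csavg_transpose`, `card_fibre_blkS∕blkV`), 213 (`hasMaj_mulVecLin_of_sum_abs_le`, `sum_fibre_abs_le_card_mul`), 235 (`hasMaj_idef_bMulShift_comp`, `hasMaj_pull_kingPr(V)_lift`),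
dag-n15-a (`card_fibre_kingProj`), the T⁴ cell (`idef`, `pull`).  Nothing in the tree is modified.

WHY.  `N_V^R = D(I−R)Dᵀ(T) − D(I−R)Dᵀ(1)`, `D(I−R)Dᵀ = E·S⁻¹·Eᵀ`, `S = MᵀM` (n15-c∕212).  The intermediate factors carry GRID-DEPENDENT normalisations (`M, E ~ n^{−(d+1)}`, `S⁻¹ ~ n^{d+1}`):
between the grids `n = L^k` and `n′ = L^mL^k` the minimizer compares through the SCALED transport `ν·id` on the unit lattice, `ν = (n′∕n)^{d+1} = L^{m(d+1)}`:
`𝔇(M) = νM′ − P̂_SM`, `𝔇(E) = νE′ − P̂_VE` (Leibniz: `M = G′(T)Q′_Tᵀ`, `E = (∂ − B)M`; inputs: the defects of `G′(T)` (236), of `∂G′(T)` (237), the block-diagonal holonomy fit of `Q′_Tᵀ`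
(`φ_t`), n15-c∕235's defect of the shifted multiplier `B`).  The TRANSPOSED factors need no new analysis: `P̂ᵀP̂ = ν·1` (constant fibres `L^{m(d+1)}`) gives EXACTLY
`M′ᵀP̂_S − Mᵀ = ν⁻¹·𝔇(M)ᵀ·P̂_S`, and a transposed block row costs the fine block cardinality (n15-c∕213): `𝔇(Mᵀ) ≤ |ι|ε_M`, `𝔇(Eᵀ) ≤ (d+1)|ι|ε_E` — n-free.
* §1 `hasMaj_mulVecLin_transpose`; `pullMat`, `mulVecLin_pullMat`, `pullMat_transpose_mul_pullMat` (`P̂ᵀP̂ = ν·1`), `transpose_idef_mul_pullMat`; `card_fibre_liftMap(_kingPr)` (the bond twin is dag-n15-c∕g4's `card_fibre_kingPrV_lift`, imported);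
* §2 ★★ `hasMaj_idef_cM`, ★★ `hasMaj_idef_cE`; §3 `mulVecLin_dM∕dE`, `mulVecLin_dMt∕dEt`, ★★ `hasMaj_idef_cM_transpose`, ★★ `hasMaj_idef_cE_transpose`.

HONEST FRAMING ∕ LIMITS.  Bookkeeping over displayed rows; MODEL carriers; NOT [Balaban1985BackgroundPropagators] Lemma 3.3 ∕ Thm 3.4 ∕ (3.49) as printed; NE2⁺ NOT PRINTED; N15 of record untouched
(DISCHARGED AS CONSUMED, p687738); counts UNMOVED (typed 28∕28 · discharged 8∕27); one finite 𝕋⁴ at fixed ε per index — NOT infinite volume ∕ OS ∕ mass gap ∕ Clay.  Restate-immune.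
-/

noncomputable section

open scoped BigOperators Matrix
open Finset

namespace Summit.QuantumFields.YangMills.BalabanUVNodes.N15.CovLandau

open Literature.MathematicalPhysics.QuantumFieldTheory.Balaban1983to89
open Literature.MathematicalPhysics.QuantumFieldTheory.Balaban1983to89.B5Prop11Plancherel (Tor fine unitVec)
open Literature.MathematicalPhysics.QuantumFieldTheory.Balaban1983to89.B11SectG (BlockNorm HasMaj RowSum hasMaj_comp_exp)
open Literature.MathematicalPhysics.QuantumFieldTheory.Balaban1983to89.B6UnitTorusCarrier (unitTorusGeo rowSum_unitTorusGeo triangle254_unitTorusGeo unitTorusGeo_dist_nonneg)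
open Literature.MathematicalPhysics.QuantumFieldTheory.Balaban1983to89.T4EtaRateDefect (idef idef_apply idef_comp idef_add idef_sub)
open Literature.MathematicalPhysics.QuantumFieldTheory.Balaban1983to89.T4EtaRateCoeffDefect (pull pull_apply fibre mem_fibre)
open Literature.MathematicalPhysics.QuantumFieldTheory.King1986.Torus (blockOf tdistT tdistT_nonneg tdistT_symm tdistT_self)
open Summit.QuantumFields.YangMills.BalabanUVNodes.N15.MatrixSpecies (liftBlk liftMap)
open Summit.QuantumFields.YangMills.BalabanUVNodes.N15.VectorPiece (kingPr kingPrV kingPr_val card_fibre_kingPrV_lift)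
open Summit.QuantumFields.YangMills.BalabanUVNodes.N15.DefectKernel (card_fibre_kingProj)
open Summit.QuantumFields.YangMills.BalabanUVNodes.N15.CovAvg (cvaStair rows_one)
open Summit.QuantumFields.YangMills.BalabanUVNodes.N15.BackgroundModel (kappa_ofBlocks)
open Summit.QuantumFields.YangMills.BalabanUVNodes.N15.TwoGrid (hasMaj_smul_ofBlocks)
open Summit.QuantumFields.YangMills.BalabanUVNodes.N15.BlockRows (hasMaj_comp_localRight hasMaj_comp_localLeft hasMaj_mulVecLin_of_sum_abs_le sum_fibre_abs_le_card_mul)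

variable {d : ℕ}

/-! ## §1 Transposed block rows, the pull-back matrix and its fibres -/

section Generic

variable {g : B6.Geometry} [DecidableEq g.Site]

/-- ★ A TRANSPOSED BLOCK ROW costs the block cardinality of the (old) target: `Aᵀ ≤ N·K(y′, y)`. [folklore] -/
theorem hasMaj_mulVecLin_transpose {X Y : Type} [Fintype X] [Fintype Y] [DecidableEq X] [DecidableEq Y] (blk₁ : X → g.Site) (blk₂ : Y → g.Site) {A : Matrix Y X ℝ}
    {K : g.Site → g.Site → ℝ} {N : ℕ} (hK : ∀ y y', 0 ≤ K y y') (hN : ∀ z, (fibre blk₂ z).card ≤ N) (h : HasMaj (BlockNorm.ofBlocks g blk₁) (BlockNorm.ofBlocks g blk₂) (Matrix.mulVecLin A) K) :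
    HasMaj (BlockNorm.ofBlocks g blk₂) (BlockNorm.ofBlocks g blk₁) (Matrix.mulVecLin Aᵀ) (fun y y' => N * K y' y) := by
  refine hasMaj_mulVecLin_of_sum_abs_le blk₂ blk₁ (fun y y' => mul_nonneg (Nat.cast_nonneg _) (hK y' y)) fun x w => ?_
  simp only [Matrix.transpose_apply]
  exact sum_fibre_abs_le_card_mul blk₁ blk₂ hK hN h w x

/-- THE PULL-BACK MATRIX of `π : X′ → X`: `P(x′, x) = 𝟙[πx′ = x]`. [folklore] -/
def pullMat {X X' : Type} [DecidableEq X] (π : X' → X) : Matrix X' X ℝ := fun x' x => if π x' = x then 1 else 0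

/-- `P` acts as the pull-back. [folklore] -/
theorem mulVecLin_pullMat {X X' : Type} [Fintype X] [DecidableEq X] (π : X' → X) : Matrix.mulVecLin (pullMat π) = pull π := by
  refine LinearMap.ext fun f => funext fun x' => ?_
  simp only [Matrix.mulVecLin_apply, Matrix.mulVec, dotProduct, pullMat, pull_apply, ite_mul, one_mul, zero_mul, Finset.sum_ite_eq, Finset.mem_univ, if_true]

/-- ★ **CONSTANT FIBRES ⇒ `PᵀP = ν·1`.** [folklore] -/
theorem pullMat_transpose_mul_pullMat {X X' : Type} [Fintype X'] [DecidableEq X] (π : X' → X) {ν : ℕ} (hν : ∀ x, (fibre π x).card = ν) :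
    (pullMat π)ᵀ * pullMat π = (ν : ℝ) • (1 : Matrix X X ℝ) := by
  ext x y
  rw [Matrix.mul_apply, Matrix.smul_apply, Matrix.one_apply, smul_eq_mul]
  by_cases hxy : x = y
  · subst hxy
    rw [if_pos rfl, mul_one]
    have h1 : ∀ x', (pullMat π)ᵀ x x' * pullMat π x' x = if π x' = x then 1 else 0 := fun x' => by
      simp only [Matrix.transpose_apply, pullMat]
      split_ifs <;> simp
    simp only [h1]
    rw [Finset.sum_boole]
    have h := hν x
    rw [fibre] at h
    exact_mod_cast h
  · rw [if_neg hxy, mul_zero]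
    refine Finset.sum_eq_zero fun x' _ => ?_
    simp only [Matrix.transpose_apply, pullMat]
    by_cases h1 : π x' = x
    · rw [if_pos h1, if_neg (fun h2 => hxy (h1.symm.trans h2)), mul_zero]
    · rw [if_neg h1, zero_mul]

/-- ★ THE TRANSPOSED DEFECT: `(νA′ − PA)ᵀP = ν(A′ᵀP − Aᵀ)` for constant fibres `ν`. [folklore] -/
theorem transpose_idef_mul_pullMat {X X' Y : Type} [Fintype X] [Fintype X'] [DecidableEq X] (π : X' → X) {ν : ℕ} (hν : ∀ x, (fibre π x).card = ν) (A' : Matrix X' Y ℝ) (A : Matrix X Y ℝ) :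
    ((ν : ℝ) • A' - pullMat π * A)ᵀ * pullMat π = (ν : ℝ) • (A'ᵀ * pullMat π - Aᵀ) := by
  rw [Matrix.transpose_sub, Matrix.transpose_smul, Matrix.transpose_mul, Matrix.sub_mul, Matrix.smul_mul, Matrix.mul_assoc, pullMat_transpose_mul_pullMat π hν, Matrix.mul_smul,
    Matrix.mul_one, smul_sub]

/-- Fibres of a lifted map: `#(liftMap π ι)⁻¹(x, i) = #π⁻¹x`. [folklore] -/
theorem card_fibre_liftMap {X X' : Type} [Fintype X'] [DecidableEq X] [DecidableEq X'] (π : X' → X) (ι : Type) [Fintype ι] [DecidableEq ι] (q : X × ι) :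
    (fibre (liftMap π ι) q).card = (fibre π q.1).card := by
  rw [show fibre (liftMap π ι) q = (fibre π q.1).map ⟨fun x' => (x', q.2), fun a b h => (Prod.ext_iff.mp h).1⟩ from ?_, Finset.card_map]
  ext p
  simp only [mem_fibre, Finset.mem_map, Function.Embedding.coeFn_mk, liftMap, Prod.ext_iff]
  constructor
  · rintro ⟨h1, h2⟩
    exact ⟨p.1, h1, rfl, h2.symm⟩
  · rintro ⟨x', hx', h1, h2⟩
    exact ⟨by rw [← h1]; exact hx', h2.symm⟩

end Generic

section Fibres

variable (M : Fin (d + 1) → ℕ) [∀ μ, NeZero (M μ)] (ι : Type) [Fintype ι] [DecidableEq ι] (L k m : ℕ) [NeZero L]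

/-- `#P̂_S⁻¹(x, i) = L^{m(d+1)}`. [cite: King1986, p.664 (pairing convention «x′ ∈ B^n(x)»)] -/
theorem card_fibre_liftMap_kingPr (q : Tor (fine (L ^ k) M) × ι) : (fibre (liftMap (kingPr L k m M) ι) q).card = (L ^ m) ^ (d + 1) := by
  rw [card_fibre_liftMap]
  exact card_fibre_kingProj L k m M (kingPr L k m M) (fun x' μ => kingPr_val L k m M x' μ) q.1

end Fibres

/-! ## §2 The defects of the minimizer and of its covariant gradient -/

section Minimizer

variable (M : Fin (d + 1) → ℕ) [∀ μ, NeZero (M μ)] {ι : Type} [Fintype ι] [DecidableEq ι] (L k m : ℕ) [NeZero L]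

/-- ★★ **THE TWO-GRID DEFECT OF THE MINIMIZER `M = G′(T)Q′_Tᵀ`** through the scaled unit transport: `νM′ − P̂_SM = G′(T′)·𝔇(Q′ᵀ) + 𝔇(G′(T))·Q′_Tᵀ ≤ n^{−(d+1)}(C_X′φ_t + ε_Xτ)e^{−δd}`
(`𝔇(Q′ᵀ) = νQ′_{T′}ᵀ − P̂_SQ′_Tᵀ` the block-diagonal holonomy fit `n^{−(d+1)}φ_t`, `ε_X` = n15-c∕236, `τ` = column staircase letter). [cite: Balaban1985BackgroundPropagators, (3.25) p.394, Thm 3.4 p.400 (mechanism); King1986, p.664] -/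
theorem hasMaj_idef_cM {T : Fin (d + 1) → Tor (fine (L ^ k) M) → Matrix ι ι ℝ} {a : ℝ} {T' : Fin (d + 1) → Tor (fine (L ^ m * L ^ k) M) → Matrix ι ι ℝ} {a' : ℝ}
    {δ CX₁ εX φt τ : ℝ} (hCX₁ : 0 ≤ CX₁) (hεX : 0 ≤ εX) (hτ0 : 0 ≤ τ)
    (hτc : ∀ y aa i, ∑ j, |cvaStair M (L ^ k) (fun μ b => T μ b.1) y aa 0 j i| ≤ τ)
    (hX' : HasMaj (BlockNorm.ofBlocks (unitTorusGeo L k M) (liftBlk (blockOf (L ^ m * L ^ k) M) ι)) (BlockNorm.ofBlocks (unitTorusGeo L k M) (liftBlk (blockOf (L ^ m * L ^ k) M) ι)) (Matrix.mulVecLin (cGreen M (L ^ m * L ^ k) T' a')) (fun y y' => CX₁ * Real.exp (-(δ * tdistT M y y'))))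
    (hXG : HasMaj (BlockNorm.ofBlocks (unitTorusGeo L k M) (liftBlk (blockOf (L ^ k) M) ι)) (BlockNorm.ofBlocks (unitTorusGeo L k M) (liftBlk (blockOf (L ^ m * L ^ k) M) ι)) (idef (pull (liftMap (kingPr L k m M) ι)) (pull (liftMap (kingPr L k m M) ι)) (Matrix.mulVecLin (cGreen M (L ^ m * L ^ k) T' a')) (Matrix.mulVecLin (cGreen M (L ^ k) T a))) (fun y y' => εX * Real.exp (-(δ * tdistT M y y'))))
    (hDQt : HasMaj (BlockNorm.ofBlocks (unitTorusGeo L k M) (liftBlk (fun y : Tor M => y) ι)) (BlockNorm.ofBlocks (unitTorusGeo L k M) (liftBlk (blockOf (L ^ m * L ^ k) M) ι)) (idef (((((L ^ m) ^ (d + 1) : ℕ) : ℝ)) • (LinearMap.id : (Tor M × ι → ℝ) →ₗ[ℝ] (Tor M × ι → ℝ))) (pull (liftMap (kingPr L k m M) ι)) (Matrix.mulVecLin (csavg M (L ^ m * L ^ k) T')ᵀ) (Matrix.mulVecLin (csavg M (L ^ k) T)ᵀ)) (fun y y' => if y = y' then (((((L ^ k : ℕ) : ℝ)) ^ (d + 1)))⁻¹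 * φt else 0)) :
    HasMaj (BlockNorm.ofBlocks (unitTorusGeo L k M) (liftBlk (fun y : Tor M => y) ι)) (BlockNorm.ofBlocks (unitTorusGeo L k M) (liftBlk (blockOf (L ^ m * L ^ k) M) ι)) (idef (((((L ^ m) ^ (d + 1) : ℕ) : ℝ)) • (LinearMap.id : (Tor M × ι → ℝ) →ₗ[ℝ] (Tor M × ι → ℝ))) (pull (liftMap (kingPr L k m M) ι)) (Matrix.mulVecLin (cM M (L ^ m * L ^ k) T' a')) (Matrix.mulVecLin (cM M (L ^ k) T a))) (fun y y' => (((((L ^ k : ℕ) : ℝ)) ^ (d + 1)))⁻¹ * (CX₁ * φt + εX * τ) * Real.exp (-(δ * tdistT M y y'))) := by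
  have hκS : (BlockNorm.ofBlocks (unitTorusGeo L k M) (liftBlk (blockOf (L ^ k) M) ι)).κ = 1 := kappa_ofBlocks _
  have hκS1 : (BlockNorm.ofBlocks (unitTorusGeo L k M) (liftBlk (blockOf (L ^ m * L ^ k) M) ι)).κ = 1 := kappa_ofBlocks _
  have hn : (0 : ℝ) < ((((L ^ k : ℕ) : ℝ)) ^ (d + 1)) := pow_pos (Nat.cast_pos.mpr (Nat.pos_of_ne_zero (NeZero.ne _))) _
  rw [cM, cM, Matrix.mulVecLin_mul (cGreen M (L ^ m * L ^ k) T' a') (csavg M (L ^ m * L ^ k) T')ᵀ, Matrix.mulVecLin_mul (cGreen M (L ^ k) T a) (csavg M (L ^ k) T)ᵀ, idef_comp (((((L ^ m) ^ (d + 1) : ℕ) : ℝ)) • (LinearMap.id : (Tor M × ι → ℝ) →ₗ[ℝ] (Tor M × ι → ℝ))) (pull (liftMap (kingPr L k m M) ι)) (pull (liftMap (kingPr L k m M) ι)) (Matrix.mulVecLin (cGreen M (L ^ m * L ^ k) T' a')) (Matrix.mulVecLin (csavg M (L ^ m * L ^ k) T')ᵀ) (Matrix.mulVecLin (cGreen M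 (L ^ k) T a)) (Matrix.mulVecLin (csavg M (L ^ k) T)ᵀ)]
  refine ((hasMaj_comp_localRight hX' hDQt fun _ _ => by positivity).add (hasMaj_comp_localRight hXG (hasMaj_csavg_transpose M (L ^ k) L k T hτ0 hτc) fun _ _ => by positivity)).mono
    fun y y' => le_of_eq ?_
  rw [hκS, hκS1]; ring

set_option maxHeartbeats 800000 in
/-- ★★ **THE TWO-GRID DEFECT OF THE COVARIANT GRADIENT OF THE MINIMIZER `E = D_TM = (∂ − B)M`**: `νE′ − P̂_VE = [∂′G′(T′)·𝔇(Q′ᵀ) + 𝔇(∂G′(T))Q′_Tᵀ] − [B′·𝔇(M) + 𝔇(B′, B)·M]`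
`≤ n^{−(d+1)}·ε_E·e^{−δd}`, `ε_E = C_Y′φ_t + ε_Yτ + (n′ρ₁e^{δ+s})ε_Mc + ω_N(e^{δ+s}C_Xc)τ + n⁻¹(n′ρ₁)C_Yτ` (`ε_Y` = n15-c∕237, `ε_M` = `hasMaj_idef_cM`, the shifted multiplier's defect by n15-c∕235).
[cite: Balaban1985BackgroundPropagators, (3.49) p.399, Thm 3.4 p.400 (mechanism); King1986, p.664] -/
theorem hasMaj_idef_cE {T : Fin (d + 1) → Tor (fine (L ^ k) M) → Matrix ι ι ℝ} {a : ℝ} {T' : Fin (d + 1) → Tor (fine (L ^ m * L ^ k) M) → Matrix ι ι ℝ} {a' : ℝ}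
    {δ s c CX CY CY₁ εY εM φt τ ρ₁ ωN : ℝ} (hs : 0 < s) (hrow : RowSum (unitTorusGeo L k M) s c) (hc : 0 ≤ c) (hδ : 0 ≤ δ)
    (hCX : 0 ≤ CX) (hCY : 0 ≤ CY) (hCY₁ : 0 ≤ CY₁) (hεY : 0 ≤ εY) (hεM : 0 ≤ εM) (hτ0 : 0 ≤ τ) (hρ₁0 : 0 ≤ ρ₁) (hωN0 : 0 ≤ ωN)
    (hτc : ∀ y aa i, ∑ j, |cvaStair M (L ^ k) (fun μ b => T μ b.1) y aa 0 j i| ≤ τ)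
    (hρr' : ∀ ν x i, ∑ j, |(T' ν x - (fun (_ : Fin (d + 1)) (_ : Tor (fine (L ^ m * L ^ k) M)) => (1 : Matrix ι ι ℝ)) ν x) i j| ≤ ρ₁)
    (hωNr : ∀ ν x' i, ∑ j, |((fun ν x => (((L ^ m * L ^ k : ℕ) : ℝ)) • ((1 : Matrix ι ι ℝ) - T' ν x)) ν x' - (fun ν x => (((L ^ k : ℕ) : ℝ)) • ((1 : Matrix ι ι ℝ) - T ν x)) ν (kingPr L k m M x')) i j| ≤ ωN)
    (hX : HasMaj (BlockNorm.ofBlocks (unitTorusGeo L k M) (liftBlk (blockOf (L ^ k) M) ι)) (BlockNorm.ofBlocks (unitTorusGeo L k M) (liftBlk (blockOf (L ^ k) M) ι)) (Matrix.mulVecLin (cGreen M (L ^ k) T a)) (fun y y' => CX * Real.exp (-(δ * tdistT M y y'))))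
    (hY : HasMaj (BlockNorm.ofBlocks (unitTorusGeo L k M) (liftBlk (blockOf (L ^ k) M) ι)) (BlockNorm.ofBlocks (unitTorusGeo L k M) (liftBlk (fun b : Tor (fine (L ^ k) M) × Fin (d + 1) => blockOf (L ^ k) M b.1) ι)) (Matrix.mulVecLin ((cgrad M (L ^ k) (fun (_ : Fin (d + 1)) (_ : Tor (fine (L ^ k) M)) => (1 : Matrix ι ι ℝ))) * (cGreen M (L ^ k) T a))) (fun y y' => CY * Real.exp (-(δ * tdistT M y y'))))
    (hY' : HasMaj (BlockNorm.ofBlocks (unitTorusGeo L k M) (liftBlk (blockOf (L ^ m * L ^ k) M) ι)) (BlockNorm.ofBlocks (unitTorusGeo L k M) (liftBlk (fun b : Tor (fine (L ^ m * L ^ k) M) × Fin (d + 1) => blockOf (L ^ m * L ^ k) M b.1) ι)) (Matrix.mulVecLin ((cgrad M (L ^ m * L ^ k) (fun (_ : Fin (d + 1)) (_ : Tor (fine (L ^ m * L ^ k) M)) => (1 : Matrix ι ι ℝ))) * (cGreen M (L ^ m * L ^ k) T' a'))) (fun y y' => CY₁ * Real.exp (-(δ * tdistT M y y'))))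
    (hYG : HasMaj (BlockNorm.ofBlocks (unitTorusGeo L k M) (liftBlk (blockOf (L ^ k) M) ι)) (BlockNorm.ofBlocks (unitTorusGeo L k M) (liftBlk (fun b : Tor (fine (L ^ m * L ^ k) M) × Fin (d + 1) => blockOf (L ^ m * L ^ k) M b.1) ι)) (idef (pull (liftMap (kingPr L k m M) ι)) (pull (liftMap (kingPrV L k m M) ι)) (Matrix.mulVecLin ((cgrad M (L ^ m * L ^ k) (fun (_ : Fin (d + 1)) (_ : Tor (fine (L ^ m * L ^ k) M)) => (1 : Matrix ι ι ℝ))) * (cGreen M (L ^ m * L ^ k) T' a'))) (Matrix.mulVecLin ((cgrad M (L ^ k) (fun (_ : Fin (d + 1)) (_ : Tor (fine (L ^ k) M)) => (1 : Matrix ι ι ℝ))) * (cGreen M (L ^ k) T a)))) (fun y y' => εY * Real.exp (-(δ * tdistT M y y'))))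
    (hDM : HasMaj (BlockNorm.ofBlocks (unitTorusGeo L k M) (liftBlk (fun y : Tor M => y) ι)) (BlockNorm.ofBlocks (unitTorusGeo L k M) (liftBlk (blockOf (L ^ m * L ^ k) M) ι)) (idef (((((L ^ m) ^ (d + 1) : ℕ) : ℝ)) • (LinearMap.id : (Tor M × ι → ℝ) →ₗ[ℝ] (Tor M × ι → ℝ))) (pull (liftMap (kingPr L k m M) ι)) (Matrix.mulVecLin (cM M (L ^ m * L ^ k) T' a')) (Matrix.mulVecLin (cM M (L ^ k) T a))) (fun y y' => (((((L ^ k : ℕ) : ℝ)) ^ (d + 1)))⁻¹ * εM * Real.exp (-(δ * tdistT M y y'))))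
    (hDQt : HasMaj (BlockNorm.ofBlocks (unitTorusGeo L k M) (liftBlk (fun y : Tor M => y) ι)) (BlockNorm.ofBlocks (unitTorusGeo L k M) (liftBlk (blockOf (L ^ m * L ^ k) M) ι)) (idef (((((L ^ m) ^ (d + 1) : ℕ) : ℝ)) • (LinearMap.id : (Tor M × ι → ℝ) →ₗ[ℝ] (Tor M × ι → ℝ))) (pull (liftMap (kingPr L k m M) ι)) (Matrix.mulVecLin (csavg M (L ^ m * L ^ k) T')ᵀ) (Matrix.mulVecLin (csavg M (L ^ k) T)ᵀ)) (fun y y' => if y = y' then (((((L ^ k : ℕ) : ℝ)) ^ (d + 1)))⁻¹ * φt else 0)) :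
    HasMaj (BlockNorm.ofBlocks (unitTorusGeo L k M) (liftBlk (fun y : Tor M => y) ι)) (BlockNorm.ofBlocks (unitTorusGeo L k M) (liftBlk (fun b : Tor (fine (L ^ m * L ^ k) M) × Fin (d + 1) => blockOf (L ^ m * L ^ k) M b.1) ι)) (idef (((((L ^ m) ^ (d + 1) : ℕ) : ℝ)) • (LinearMap.id : (Tor M × ι → ℝ) →ₗ[ℝ] (Tor M × ι → ℝ))) (pull (liftMap (kingPrV L k m M) ι)) (Matrix.mulVecLin (cE M (L ^ m * L ^ k) T' a')) (Matrix.mulVecLin (cE M (L ^ k) T a))) (fun y y' => (((((L ^ k : ℕ) : ℝ)) ^ (d + 1)))⁻¹ * (CY₁ * φt + εY * τ + ((((L ^ m * L ^ k : ℕ) : ℝ)) * ρ₁ * Real.exp (δ + s)) * εM * c + ωN * (Real.exp (δ + s) * CX * c) * τ + ((((L ^ k : ℕ) : ℝ)))⁻¹ * ((((L ^ m * L ^ k : ℕ) : ℝ)) * ρ₁) * CY * τ) * Real.exp (-(δ * tdistT M y y'))) := by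
  have hκS : (BlockNorm.ofBlocks (unitTorusGeo L k M) (liftBlk (blockOf (L ^ k) M) ι)).κ = 1 := kappa_ofBlocks _
  have hκV : (BlockNorm.ofBlocks (unitTorusGeo L k M) (liftBlk (fun b : Tor (fine (L ^ k) M) × Fin (d + 1) => blockOf (L ^ k) M b.1) ι)).κ = 1 := kappa_ofBlocks _
  have hκS1 : (BlockNorm.ofBlocks (unitTorusGeo L k M) (liftBlk (blockOf (L ^ m * L ^ k) M) ι)).κ = 1 := kappa_ofBlocks _
  have hκV1 : (BlockNorm.ofBlocks (unitTorusGeo L k M) (liftBlk (fun b : Tor (fine (L ^ m * L ^ k) M) × Fin (d + 1) => blockOf (L ^ m * L ^ k) M b.1) ι)).κ = 1 := kappa_ofBlocks _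
  have hn : (0 : ℝ) < ((((L ^ k : ℕ) : ℝ)) ^ (d + 1)) := pow_pos (Nat.cast_pos.mpr (Nat.pos_of_ne_zero (NeZero.ne _))) _
  have hn1 : (0 : ℝ) ≤ (((L ^ k : ℕ) : ℝ)) := Nat.cast_nonneg _
  have hn1' : (0 : ℝ) ≤ (((L ^ m * L ^ k : ℕ) : ℝ)) := Nat.cast_nonneg _
  have htri := triangle254_unitTorusGeo L k M
  have hd := unitTorusGeo_dist_nonneg L k M
  -- `E = ∂G′(T)·Q′ᵀ − B·M` on both grids
  have hDc : (cgrad M (L ^ k) (fun (_ : Fin (d + 1)) (_ : Tor (fine (L ^ k) M)) => (1 : Matrix ι ι ℝ))) * (cM M (L ^ k) T a) = ((cgrad M (L ^ k) (fun (_ : Fin (d + 1)) (_ : Tor (fine (L ^ k) M)) => (1 : Matrix ι ι ℝ))) * (cGreen M (L ^ k) T a)) * (csavg M (L ^ k) T)ᵀ := by rw [cM, Matrix.mul_assoc]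
  have hDc' : (cgrad M (L ^ m * L ^ k) (fun (_ : Fin (d + 1)) (_ : Tor (fine (L ^ m * L ^ k) M)) => (1 : Matrix ι ι ℝ))) * (cM M (L ^ m * L ^ k) T' a') = ((cgrad M (L ^ m * L ^ k) (fun (_ : Fin (d + 1)) (_ : Tor (fine (L ^ m * L ^ k) M)) => (1 : Matrix ι ι ℝ))) * (cGreen M (L ^ m * L ^ k) T' a')) * (csavg M (L ^ m * L ^ k) T')ᵀ := by rw [cM, Matrix.mul_assoc]
  have hcE : Matrix.mulVecLin (cE M (L ^ k) T a) = Matrix.mulVecLin ((cgrad M (L ^ k) (fun (_ : Fin (d + 1)) (_ : Tor (fine (L ^ k) M)) => (1 : Matrix ι ι ℝ))) * (cGreen M (L ^ k) T a)) ∘ₗ Matrix.mulVecLin (csavg M (L ^ k) T)ᵀ - Matrix.mulVecLin ((cgrad M (L ^ k) (fun (_ : Fin (d + 1)) (_ : Tor (fine (L ^ k) M)) => (1 : Matrix ι ι ℝ))) - cgrad M (L ^ k) T) ∘ₗ Matrix.mulVecLin (cM M (L ^ k) T a) := by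
    conv_lhs => rw [cE_eq_cgrad_mul_cM, show cgrad M (L ^ k) T = (cgrad M (L ^ k) (fun (_ : Fin (d + 1)) (_ : Tor (fine (L ^ k) M)) => (1 : Matrix ι ι ℝ))) - ((cgrad M (L ^ k) (fun (_ : Fin (d + 1)) (_ : Tor (fine (L ^ k) M)) => (1 : Matrix ι ι ℝ))) - cgrad M (L ^ k) T) from (sub_sub_cancel _ _).symm, Matrix.sub_mul, hDc]
    rw [mulVecLin_sub', Matrix.mulVecLin_mul ((cgrad M (L ^ k) (fun (_ : Fin (d + 1)) (_ : Tor (fine (L ^ k) M)) => (1 : Matrix ι ι ℝ))) * (cGreen M (L ^ k) T a)) (csavg M (L ^ k) T)ᵀ, Matrix.mulVecLin_mul ((cgrad M (L ^ k) (fun (_ : Fin (d + 1)) (_ : Tor (fine (L ^ k) M)) => (1 : Matrix ι ι ℝ))) - cgrad M (L ^ k) T) (cM M (L ^ k) T a)]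
  have hcE' : Matrix.mulVecLin (cE M (L ^ m * L ^ k) T' a') = Matrix.mulVecLin ((cgrad M (L ^ m * L ^ k) (fun (_ : Fin (d + 1)) (_ : Tor (fine (L ^ m * L ^ k) M)) => (1 : Matrix ι ι ℝ))) * (cGreen M (L ^ m * L ^ k) T' a')) ∘ₗ Matrix.mulVecLin (csavg M (L ^ m * L ^ k) T')ᵀ - Matrix.mulVecLin ((cgrad M (L ^ m * L ^ k) (fun (_ : Fin (d + 1)) (_ : Tor (fine (L ^ m * L ^ k) M)) => (1 : Matrix ι ι ℝ))) - cgrad M (L ^ m * L ^ k) T') ∘ₗ Matrix.mulVecLin (cM M (L ^ m * L ^ k) T' a') := by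
    conv_lhs => rw [cE_eq_cgrad_mul_cM, show cgrad M (L ^ m * L ^ k) T' = (cgrad M (L ^ m * L ^ k) (fun (_ : Fin (d + 1)) (_ : Tor (fine (L ^ m * L ^ k) M)) => (1 : Matrix ι ι ℝ))) - ((cgrad M (L ^ m * L ^ k) (fun (_ : Fin (d + 1)) (_ : Tor (fine (L ^ m * L ^ k) M)) => (1 : Matrix ι ι ℝ))) - cgrad M (L ^ m * L ^ k) T') from (sub_sub_cancel _ _).symm, Matrix.sub_mul, hDc']
    rw [mulVecLin_sub', Matrix.mulVecLin_mul ((cgrad M (L ^ m * L ^ k) (fun (_ : Fin (d + 1)) (_ : Tor (fine (L ^ m * L ^ k) M)) => (1 : Matrix ι ι ℝ))) * (cGreen M (L ^ m * L ^ k) T' a')) (csavg M (L ^ m * L ^ k) T')ᵀ, Matrix.mulVecLin_mul ((cgrad M (L ^ m * L ^ k) (fun (_ : Fin (d + 1)) (_ : Tor (fine (L ^ m * L ^ k) M)) => (1 : Matrix ι ι ℝ))) - cgrad M (L ^ m * L ^ k) T') (cM M (L ^ m * L ^ k) T' a')]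
  -- one-grid pieces
  have hQt := hasMaj_csavg_transpose M (L ^ k) L k T hτ0 hτc
  have hWr' : ∀ μ x i, ∑ j, |(fun ν x => (((L ^ m * L ^ k : ℕ) : ℝ)) • ((1 : Matrix ι ι ℝ) - T' ν x)) μ x i j| ≤ (((L ^ m * L ^ k : ℕ) : ℝ)) * ρ₁ := by
    intro μ x i
    have h := hρr' μ x i
    calc ∑ j, |(fun ν x => (((L ^ m * L ^ k : ℕ) : ℝ)) • ((1 : Matrix ι ι ℝ) - T' ν x)) μ x i j| = (((L ^ m * L ^ k : ℕ) : ℝ)) * ∑ j, |(T' μ x - (fun (_ : Fin (d + 1)) (_ : Tor (fine (L ^ m * L ^ k) M)) => (1 : Matrix ι ι ℝ)) μ x) i j| := by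
          rw [Finset.mul_sum]; refine Finset.sum_congr rfl fun j _ => ?_
          simp only [Matrix.smul_apply, smul_eq_mul, abs_mul, abs_of_nonneg hn1', Matrix.sub_apply, Matrix.one_apply]
          rw [abs_sub_comm]
      _ ≤ (((L ^ m * L ^ k : ℕ) : ℝ)) * ρ₁ := mul_le_mul_of_nonneg_left h hn1'
  have hBs' : HasMaj (BlockNorm.ofBlocks (unitTorusGeo L k M) (liftBlk (blockOf (L ^ m * L ^ k) M) ι)) (BlockNorm.ofBlocks (unitTorusGeo L k M) (liftBlk (fun b : Tor (fine (L ^ m * L ^ k) M) × Fin (d + 1) => blockOf (L ^ m * L ^ k) M b.1) ι)) (Matrix.mulVecLin ((cgrad M (L ^ m * L ^ k) (fun (_ : Fin (d + 1)) (_ : Tor (fine (L ^ m * L ^ k) M)) => (1 : Matrix ι ι ℝ))) - cgrad M (L ^ m * L ^ k) T')) (fun y y' => (((L ^ m * L ^ k : ℕ) : ℝ)) * ρ₁ * Real.exp (δ + s) * Real.exp (-((δ + s) * tdistT M y y'))) := by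
    rw [show ((cgrad M (L ^ m * L ^ k) (fun (_ : Fin (d + 1)) (_ : Tor (fine (L ^ m * L ^ k) M)) => (1 : Matrix ι ι ℝ))) - cgrad M (L ^ m * L ^ k) T') = -(cgrad M (L ^ m * L ^ k) T' - (cgrad M (L ^ m * L ^ k) (fun (_ : Fin (d + 1)) (_ : Tor (fine (L ^ m * L ^ k) M)) => (1 : Matrix ι ι ℝ)))) from (neg_sub _ _).symm, mulVecLin_neg']
    exact (hasMaj_cgrad_sub M (L ^ m * L ^ k) L k T' hρ₁0 (by linarith : 0 ≤ δ + s) hρr').neg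
  have hS1 : HasMaj (BlockNorm.ofBlocks (unitTorusGeo L k M) (liftBlk (blockOf (L ^ k) M) ι)) (BlockNorm.ofBlocks (unitTorusGeo L k M) (liftBlk (fun b : Tor (fine (L ^ k) M) × Fin (d + 1) => blockOf (L ^ k) M b.1) ι)) (Matrix.mulVecLin (bShift M (L ^ k) (ι := ι))) (fun y y' => 1 * Real.exp (δ + s) * Real.exp (-((δ + s) * tdistT M y y'))) := by
    rw [bShift_eq_bMulShift_one]
    exact hasMaj_bMulShift M (L ^ k) L k (fun (_ : Fin (d + 1)) (_ : Tor (fine (L ^ k) M)) => (1 : Matrix ι ι ℝ)) zero_le_one (by linarith : 0 ≤ δ + s) (fun ν x i => (rows_one i).le)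
  have hSG : HasMaj (BlockNorm.ofBlocks (unitTorusGeo L k M) (liftBlk (blockOf (L ^ k) M) ι)) (BlockNorm.ofBlocks (unitTorusGeo L k M) (liftBlk (fun b : Tor (fine (L ^ k) M) × Fin (d + 1) => blockOf (L ^ k) M b.1) ι)) (Matrix.mulVecLin (bShift M (L ^ k) (ι := ι)) ∘ₗ Matrix.mulVecLin (cGreen M (L ^ k) T a)) (fun y y' => (Real.exp (δ + s) * CX * c) * Real.exp (-(δ * tdistT M y y'))) :=
    (hasMaj_comp_exp (ρ := δ) htri hd hrow (by positivity) hCX hδ le_rfl (by linarith) hS1 hX).mono fun y y' => le_of_eq (by rw [hκS]; ring)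
  have hSM : HasMaj (BlockNorm.ofBlocks (unitTorusGeo L k M) (liftBlk (fun y : Tor M => y) ι)) (BlockNorm.ofBlocks (unitTorusGeo L k M) (liftBlk (fun b : Tor (fine (L ^ k) M) × Fin (d + 1) => blockOf (L ^ k) M b.1) ι)) (Matrix.mulVecLin (bShift M (L ^ k) (ι := ι)) ∘ₗ Matrix.mulVecLin (cM M (L ^ k) T a)) (fun y y' => (Real.exp (δ + s) * CX * c) * ((((((L ^ k : ℕ) : ℝ)) ^ (d + 1)))⁻¹ * τ) * Real.exp (-(δ * tdistT M y y'))) := by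
    rw [cM, Matrix.mulVecLin_mul (cGreen M (L ^ k) T a) (csavg M (L ^ k) T)ᵀ, ← LinearMap.comp_assoc]
    exact (hasMaj_comp_localRight hSG hQt fun _ _ => by positivity).mono fun y y' => le_of_eq (by rw [hκS]; ring)
  have hDMc : HasMaj (BlockNorm.ofBlocks (unitTorusGeo L k M) (liftBlk (fun y : Tor M => y) ι)) (BlockNorm.ofBlocks (unitTorusGeo L k M) (liftBlk (fun b : Tor (fine (L ^ k) M) × Fin (d + 1) => blockOf (L ^ k) M b.1) ι)) (Matrix.mulVecLin (cgrad M (L ^ k) (fun (_ : Fin (d + 1)) (_ : Tor (fine (L ^ k) M)) => (1 : Matrix ι ι ℝ))) ∘ₗ Matrix.mulVecLin (cM M (L ^ k) T a)) (fun y y' => (CY * ((((((L ^ k : ℕ) : ℝ)) ^ (d + 1)))⁻¹ * τ)) * Real.exp (-(δ * tdistT M y y'))) := by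
    rw [← Matrix.mulVecLin_mul, hDc, Matrix.mulVecLin_mul ((cgrad M (L ^ k) (fun (_ : Fin (d + 1)) (_ : Tor (fine (L ^ k) M)) => (1 : Matrix ι ι ℝ))) * (cGreen M (L ^ k) T a)) (csavg M (L ^ k) T)ᵀ]
    exact (hasMaj_comp_localRight hY hQt fun _ _ => by positivity).mono fun y y' => le_of_eq (by rw [hκS]; ring)
  -- two-grid pieces
  have p1 : HasMaj (BlockNorm.ofBlocks (unitTorusGeo L k M) (liftBlk (fun y : Tor M => y) ι)) (BlockNorm.ofBlocks (unitTorusGeo L k M) (liftBlk (fun b : Tor (fine (L ^ m * L ^ k) M) × Fin (d + 1) => blockOf (L ^ m * L ^ k) M b.1) ι)) (Matrix.mulVecLin ((cgrad M (L ^ m * L ^ k) (fun (_ : Fin (d + 1)) (_ : Tor (fine (L ^ m * L ^ k) M)) => (1 : Matrix ι ι ℝ))) * (cGreen M (L ^ m * L ^ k) T' a')) ∘ₗ idef (((((L ^ m) ^ (d + 1) : ℕ) : ℝ)) • (LinearMap.id : (Tor M × ι → ℝ) →ₗ[ℝ] (Tor M × ι → ℝ))) (pull (liftMap (kingPr L k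 m M) ι)) (Matrix.mulVecLin (csavg M (L ^ m * L ^ k) T')ᵀ) (Matrix.mulVecLin (csavg M (L ^ k) T)ᵀ)) (fun y y' => (CY₁ * φt * (((((L ^ k : ℕ) : ℝ)) ^ (d + 1)))⁻¹) * Real.exp (-(δ * tdistT M y y'))) :=
    (hasMaj_comp_localRight hY' hDQt fun _ _ => by positivity).mono fun y y' => le_of_eq (by rw [hκS1]; ring)
  have p2 : HasMaj (BlockNorm.ofBlocks (unitTorusGeo L k M) (liftBlk (fun y : Tor M => y) ι)) (BlockNorm.ofBlocks (unitTorusGeo L k M) (liftBlk (fun b : Tor (fine (L ^ m * L ^ k) M) × Fin (d + 1) => blockOf (L ^ m * L ^ k) M b.1) ι)) (idef (pull (liftMap (kingPr L k m M) ι)) (pull (liftMap (kingPrV L k m M) ι)) (Matrix.mulVecLin ((cgrad M (L ^ m * L ^ k) (fun (_ : Fin (d + 1)) (_ : Tor (fine (L ^ m * L ^ k) M)) => (1 : Matrix ι ι ℝ))) * (cGreen M (L ^ m * L ^ k) T' a'))) (Matrix.mulVecLin ((cgrad M (L ^ k) (fun (_ : Fin (d + 1)) (_ : Tor (fine (L ^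 k) M)) => (1 : Matrix ι ι ℝ))) * (cGreen M (L ^ k) T a))) ∘ₗ Matrix.mulVecLin (csavg M (L ^ k) T)ᵀ) (fun y y' => (εY * τ * (((((L ^ k : ℕ) : ℝ)) ^ (d + 1)))⁻¹) * Real.exp (-(δ * tdistT M y y'))) :=
    (hasMaj_comp_localRight hYG hQt fun _ _ => by positivity).mono fun y y' => le_of_eq (by rw [hκS]; ring)
  have p3 : HasMaj (BlockNorm.ofBlocks (unitTorusGeo L k M) (liftBlk (fun y : Tor M => y) ι)) (BlockNorm.ofBlocks (unitTorusGeo L k M) (liftBlk (fun b : Tor (fine (L ^ m * L ^ k) M) × Fin (d + 1) => blockOf (L ^ m * L ^ k) M b.1) ι)) (Matrix.mulVecLin ((cgrad M (L ^ m * L ^ k) (fun (_ : Fin (d + 1)) (_ : Tor (fine (L ^ m * L ^ k) M)) => (1 : Matrix ι ι ℝ))) - cgrad M (L ^ m * L ^ k) T') ∘ₗ idef (((((L ^ m) ^ (d + 1) : ℕ) : ℝ)) • (LinearMap.id : (Tor M × ι → ℝ) →ₗ[ℝ] (Tor M × ι → ℝ))) (pull (liftMap (kingPr L k m M) ι)) (Matrix.mulVecLin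 (cM M (L ^ m * L ^ k) T' a')) (Matrix.mulVecLin (cM M (L ^ k) T a))) (fun y y' => (((((L ^ m * L ^ k : ℕ) : ℝ)) * ρ₁ * Real.exp (δ + s)) * εM * c * (((((L ^ k : ℕ) : ℝ)) ^ (d + 1)))⁻¹) * Real.exp (-(δ * tdistT M y y'))) :=
    (hasMaj_comp_exp (ρ := δ) htri hd hrow (by positivity) (by positivity) hδ le_rfl (by linarith) hBs' hDM).mono fun y y' => le_of_eq (by rw [hκS1]; ring)
  have p4 : HasMaj (BlockNorm.ofBlocks (unitTorusGeo L k M) (liftBlk (fun y : Tor M => y) ι)) (BlockNorm.ofBlocks (unitTorusGeo L k M) (liftBlk (fun b : Tor (fine (L ^ m * L ^ k) M) × Fin (d + 1) => blockOf (L ^ m * L ^ k) M b.1) ι)) (idef (pull (liftMap (kingPr L k m M) ι)) (pull (liftMap (kingPrV L k m M) ι)) (Matrix.mulVecLin ((cgrad M (L ^ m * L ^ k) (fun (_ : Fin (d + 1)) (_ : Tor (fine (L ^ m * L ^ k) M)) => (1 : Matrix ι ι ℝ))) - cgrad M (L ^ m * L ^ k) T')) (Matrix.mulVecLin ((cgrad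 M (L ^ k) (fun (_ : Fin (d + 1)) (_ : Tor (fine (L ^ k) M)) => (1 : Matrix ι ι ℝ))) - cgrad M (L ^ k) T)) ∘ₗ Matrix.mulVecLin (cM M (L ^ k) T a))
      (fun y y' => (ωN * (Real.exp (δ + s) * CX * c) * τ * (((((L ^ k : ℕ) : ℝ)) ^ (d + 1)))⁻¹ + ((((L ^ k : ℕ) : ℝ)))⁻¹ * ((((L ^ m * L ^ k : ℕ) : ℝ)) * ρ₁) * (CY * τ * (((((L ^ k : ℕ) : ℝ)) ^ (d + 1)))⁻¹)) * Real.exp (-(δ * tdistT M y y'))) := by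
    rw [cgrad_one_sub_eq_bMulShift, cgrad_one_sub_eq_bMulShift]
    exact (hasMaj_idef_bMulShift_comp M L k m (fun ν x => (((L ^ m * L ^ k : ℕ) : ℝ)) • ((1 : Matrix ι ι ℝ) - T' ν x)) (fun ν x => (((L ^ k : ℕ) : ℝ)) • ((1 : Matrix ι ι ℝ) - T ν x)) hωN0 (by positivity) (fun y y' => by positivity) hωNr hWr' hSM hDMc).mono fun y y' => le_of_eq (by ring)
  rw [hcE, hcE', idef_sub, idef_comp (((((L ^ m) ^ (d + 1) : ℕ) : ℝ)) • (LinearMap.id : (Tor M × ι → ℝ) →ₗ[ℝ] (Tor M × ι → ℝ))) (pull (liftMap (kingPr L k m M) ι)) (pull (liftMap (kingPrV L k m M) ι)) (Matrix.mulVecLin ((cgrad M (L ^ m * L ^ k) (fun (_ : Fin (d + 1)) (_ : Tor (fine (L ^ m * L ^ k) M)) => (1 : Matrix ι ι ℝ))) * (cGreen M (L ^ m * L ^ k) T' a'))) (Matrix.mulVecLin (csavg M (L ^ m * L ^ k) T')ᵀ) (Matrix.mulVecLin ((cgrad M (L ^ k) (fun (_ : Fin (d + 1)) (_ : Tor (fine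 (L ^ k) M)) => (1 : Matrix ι ι ℝ))) * (cGreen M (L ^ k) T a))) (Matrix.mulVecLin (csavg M (L ^ k) T)ᵀ),
    idef_comp (((((L ^ m) ^ (d + 1) : ℕ) : ℝ)) • (LinearMap.id : (Tor M × ι → ℝ) →ₗ[ℝ] (Tor M × ι → ℝ))) (pull (liftMap (kingPr L k m M) ι)) (pull (liftMap (kingPrV L k m M) ι)) (Matrix.mulVecLin ((cgrad M (L ^ m * L ^ k) (fun (_ : Fin (d + 1)) (_ : Tor (fine (L ^ m * L ^ k) M)) => (1 : Matrix ι ι ℝ))) - cgrad M (L ^ m * L ^ k) T')) (Matrix.mulVecLin (cM M (L ^ m * L ^ k) T' a')) (Matrix.mulVecLin ((cgrad M (L ^ k) (fun (_ : Fin (d + 1)) (_ : Tor (fine (L ^ k) M)) => (1 : Matrix ι ι ℝ))) - cgrad M (L ^ k) T)) (Matrix.mulVecLin (cM M (L ^ k) T a))]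
  refine ((p1.add p2).sub (p3.add p4)).mono fun y y' => le_of_eq ?_
  ring

end Minimizer

/-! ## §3 The transposed defects -/

section Transposed

variable (M : Fin (d + 1) → ℕ) [∀ μ, NeZero (M μ)] {ι : Type} [Fintype ι] [DecidableEq ι] (L k m : ℕ) [NeZero L]

/-- The minimizer defect as a matrix: `νM′ − P·M`. [folklore] -/
theorem mulVecLin_dM (T : Fin (d + 1) → Tor (fine (L ^ k) M) → Matrix ι ι ℝ) (a : ℝ) (T' : Fin (d + 1) → Tor (fine (L ^ m * L ^ k) M) → Matrix ι ι ℝ) (a' : ℝ) :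
    Matrix.mulVecLin (((((L ^ m) ^ (d + 1) : ℕ) : ℝ)) • (cM M (L ^ m * L ^ k) T' a') - (pullMat (liftMap (kingPr L k m M) ι)) * (cM M (L ^ k) T a)) = idef (((((L ^ m) ^ (d + 1) : ℕ) : ℝ)) • (LinearMap.id : (Tor M × ι → ℝ) →ₗ[ℝ] (Tor M × ι → ℝ))) (pull (liftMap (kingPr L k m M) ι)) (Matrix.mulVecLin (cM M (L ^ m * L ^ k) T' a')) (Matrix.mulVecLin (cM M (L ^ k) T a)) := by
  rw [idef, LinearMap.comp_smul, LinearMap.comp_id, mulVecLin_sub', mulVecLin_smul', Matrix.mulVecLin_mul, mulVecLin_pullMat]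

/-- The gradient defect as a matrix: `νE′ − P·E`. [folklore] -/
theorem mulVecLin_dE (T : Fin (d + 1) → Tor (fine (L ^ k) M) → Matrix ι ι ℝ) (a : ℝ) (T' : Fin (d + 1) → Tor (fine (L ^ m * L ^ k) M) → Matrix ι ι ℝ) (a' : ℝ) :
    Matrix.mulVecLin (((((L ^ m) ^ (d + 1) : ℕ) : ℝ)) • (cE M (L ^ m * L ^ k) T' a') - (pullMat (liftMap (kingPrV L k m M) ι)) * (cE M (L ^ k) T a)) = idef (((((L ^ m) ^ (d + 1) : ℕ) : ℝ)) • (LinearMap.id : (Tor M × ι → ℝ) →ₗ[ℝ] (Tor M × ι → ℝ))) (pull (liftMap (kingPrV L k m M) ι)) (Matrix.mulVecLin (cE M (L ^ m * L ^ k) T' a')) (Matrix.mulVecLin (cE M (L ^ k) T a)) := by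
  rw [idef, LinearMap.comp_smul, LinearMap.comp_id, mulVecLin_sub', mulVecLin_smul', Matrix.mulVecLin_mul, mulVecLin_pullMat]

/-- The transposed minimizer defect as a matrix: `M′ᵀP − Mᵀ`. [folklore] -/
theorem mulVecLin_dMt (T : Fin (d + 1) → Tor (fine (L ^ k) M) → Matrix ι ι ℝ) (a : ℝ) (T' : Fin (d + 1) → Tor (fine (L ^ m * L ^ k) M) → Matrix ι ι ℝ) (a' : ℝ) :
    Matrix.mulVecLin (((cM M (L ^ m * L ^ k) T' a'))ᵀ * (pullMat (liftMap (kingPr L k m M) ι)) - ((cM M (L ^ k) T a))ᵀ) = idef (pull (liftMap (kingPr L k m M) ι)) (LinearMap.id : (Tor M × ι → ℝ) →ₗ[ℝ] (Tor M × ι → ℝ)) (Matrix.mulVecLin ((cM M (L ^ m * L ^ k) T' a'))ᵀ) (Matrix.mulVecLin ((cM M (L ^ k) T a))ᵀ) := by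
  rw [idef, LinearMap.id_comp, mulVecLin_sub', Matrix.mulVecLin_mul, mulVecLin_pullMat]

/-- The transposed gradient defect as a matrix: `E′ᵀP − Eᵀ`. [folklore] -/
theorem mulVecLin_dEt (T : Fin (d + 1) → Tor (fine (L ^ k) M) → Matrix ι ι ℝ) (a : ℝ) (T' : Fin (d + 1) → Tor (fine (L ^ m * L ^ k) M) → Matrix ι ι ℝ) (a' : ℝ) :
    Matrix.mulVecLin (((cE M (L ^ m * L ^ k) T' a'))ᵀ * (pullMat (liftMap (kingPrV L k m M) ι)) - ((cE M (L ^ k) T a))ᵀ) = idef (pull (liftMap (kingPrV L k m M) ι)) (LinearMap.id : (Tor M × ι → ℝ) →ₗ[ℝ] (Tor M × ι → ℝ)) (Matrix.mulVecLin ((cE M (L ^ m * L ^ k) T' a'))ᵀ) (Matrix.mulVecLin ((cE M (L ^ k) T a))ᵀ) := by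
  rw [idef, LinearMap.id_comp, mulVecLin_sub', Matrix.mulVecLin_mul, mulVecLin_pullMat]

set_option maxHeartbeats 800000 in
/-- ★★ **THE TRANSPOSED MINIMIZER DEFECT** `M′ᵀP̂_S − Mᵀ = ν⁻¹·𝔇(M)ᵀ·P̂_S ≤ |ι|·ε_M·e^{−δd}` (the fine scalar block holds `n′^{d+1}|ι| = ν·n^{d+1}|ι|` points). [cite: Balaban1985BackgroundPropagators, (3.49) p.399 (the transposed factor); King1986, p.664] -/
theorem hasMaj_idef_cM_transpose {T : Fin (d + 1) → Tor (fine (L ^ k) M) → Matrix ι ι ℝ} {a : ℝ} {T' : Fin (d + 1) → Tor (fine (L ^ m * L ^ k) M) → Matrix ι ι ℝ} {a' : ℝ} {δ εM : ℝ} (hεM : 0 ≤ εM)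
    (hDM : HasMaj (BlockNorm.ofBlocks (unitTorusGeo L k M) (liftBlk (fun y : Tor M => y) ι)) (BlockNorm.ofBlocks (unitTorusGeo L k M) (liftBlk (blockOf (L ^ m * L ^ k) M) ι)) (idef (((((L ^ m) ^ (d + 1) : ℕ) : ℝ)) • (LinearMap.id : (Tor M × ι → ℝ) →ₗ[ℝ] (Tor M × ι → ℝ))) (pull (liftMap (kingPr L k m M) ι)) (Matrix.mulVecLin (cM M (L ^ m * L ^ k) T' a')) (Matrix.mulVecLin (cM M (L ^ k) T a))) (fun y y' => (((((L ^ k : ℕ) : ℝ)) ^ (d + 1)))⁻¹ * εM * Real.exp (-(δ * tdistT M y y')))) :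
    HasMaj (BlockNorm.ofBlocks (unitTorusGeo L k M) (liftBlk (blockOf (L ^ k) M) ι)) (BlockNorm.ofBlocks (unitTorusGeo L k M) (liftBlk (fun y : Tor M => y) ι)) (idef (pull (liftMap (kingPr L k m M) ι)) (LinearMap.id : (Tor M × ι → ℝ) →ₗ[ℝ] (Tor M × ι → ℝ)) (Matrix.mulVecLin ((cM M (L ^ m * L ^ k) T' a'))ᵀ) (Matrix.mulVecLin ((cM M (L ^ k) T a))ᵀ)) (fun y y' => (Fintype.card ι * εM) * Real.exp (-(δ * tdistT M y y'))) := by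
  have hκS1 : (BlockNorm.ofBlocks (unitTorusGeo L k M) (liftBlk (blockOf (L ^ m * L ^ k) M) ι)).κ = 1 := kappa_ofBlocks _
  have hNU : ((((L ^ m) ^ (d + 1) : ℕ) : ℝ)) ≠ 0 := Nat.cast_ne_zero.mpr (pow_ne_zero _ (pow_ne_zero _ (NeZero.ne L)))
  have hν := card_fibre_liftMap_kingPr M ι L k m
  rw [← mulVecLin_dM] at hDM
  have hT := hasMaj_mulVecLin_transpose (g := unitTorusGeo L k M) (liftBlk (fun y : Tor M => y) ι) (liftBlk (blockOf (L ^ m * L ^ k) M) ι) (K := fun y y' => (((((L ^ k : ℕ) : ℝ)) ^ (d + 1)))⁻¹ * εM * Real.exp (-(δ * tdistT M y y'))) (N := (L ^ m * L ^ k) ^ (d + 1) * Fintype.card ι)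
    (fun y y' => by positivity) (fun z => (card_fibre_blkS M (L ^ m * L ^ k) ι z).le) hDM
  have hTP := hasMaj_comp_localRight hT (hasMaj_pull_kingPr_lift M L k m (ι := ι)) fun y y' => by positivity
  have h := hasMaj_smul_ofBlocks (g := unitTorusGeo L k M) (liftBlk (fun y : Tor M => y) ι) (K := fun y y' => (((L ^ m * L ^ k) ^ (d + 1) * Fintype.card ι : ℕ) : ℝ) * ((((((L ^ k : ℕ) : ℝ)) ^ (d + 1)))⁻¹ * εM * Real.exp (-(δ * tdistT M y' y))) * ((BlockNorm.ofBlocks (unitTorusGeo L k M) (liftBlk (blockOf (L ^ m * L ^ k) M) ι)).κ * 1))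
    (fun y y' => mul_nonneg (mul_nonneg (Nat.cast_nonneg _) (by positivity)) (mul_nonneg (BlockNorm.κ_nonneg _) zero_le_one)) (((((L ^ m) ^ (d + 1) : ℕ) : ℝ)))⁻¹ hTP
  rw [← mulVecLin_dMt, show ((cM M (L ^ m * L ^ k) T' a'))ᵀ * (pullMat (liftMap (kingPr L k m M) ι)) - ((cM M (L ^ k) T a))ᵀ = (((((L ^ m) ^ (d + 1) : ℕ) : ℝ)))⁻¹ • (((((((L ^ m) ^ (d + 1) : ℕ) : ℝ)) • (cM M (L ^ m * L ^ k) T' a') - (pullMat (liftMap (kingPr L k m M) ι)) * (cM M (L ^ k) T a)))ᵀ * (pullMat (liftMap (kingPr L k m M) ι))) by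
    rw [transpose_idef_mul_pullMat _ hν, smul_smul, inv_mul_cancel₀ hNU, one_smul], mulVecLin_smul', Matrix.mulVecLin_mul, mulVecLin_pullMat]
  refine h.mono fun y y' => le_of_eq ?_
  rw [hκS1, tdistT_symm M y' y, abs_of_nonneg (inv_nonneg.mpr (by positivity : (0 : ℝ) ≤ ((((L ^ m) ^ (d + 1) : ℕ) : ℝ))))]
  have hL : (L : ℝ) ≠ 0 := Nat.cast_ne_zero.mpr (NeZero.ne L)
  push_cast
  field_simp
  ring

set_option maxHeartbeats 800000 in
/-- ★★ **THE TRANSPOSED GRADIENT DEFECT** `E′ᵀP̂_V − Eᵀ = ν⁻¹·𝔇(E)ᵀ·P̂_V ≤ (d+1)|ι|·ε_E·e^{−δd}`. [cite: Balaban1985BackgroundPropagators, (3.49) p.399; King1986, p.664] -/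
theorem hasMaj_idef_cE_transpose {T : Fin (d + 1) → Tor (fine (L ^ k) M) → Matrix ι ι ℝ} {a : ℝ} {T' : Fin (d + 1) → Tor (fine (L ^ m * L ^ k) M) → Matrix ι ι ℝ} {a' : ℝ} {δ εE : ℝ} (hεE : 0 ≤ εE)
    (hDE : HasMaj (BlockNorm.ofBlocks (unitTorusGeo L k M) (liftBlk (fun y : Tor M => y) ι)) (BlockNorm.ofBlocks (unitTorusGeo L k M) (liftBlk (fun b : Tor (fine (L ^ m * L ^ k) M) × Fin (d + 1) => blockOf (L ^ m * L ^ k) M b.1) ι)) (idef (((((L ^ m) ^ (d + 1) : ℕ) : ℝ)) • (LinearMap.id : (Tor M × ι → ℝ) →ₗ[ℝ] (Tor M × ι → ℝ))) (pull (liftMap (kingPrV L k m M) ι)) (Matrix.mulVecLin (cE M (L ^ m * L ^ k) T' a')) (Matrix.mulVecLin (cE M (L ^ k) T a))) (fun y y' => (((((L ^ k : ℕ) : ℝ)) ^ (d + 1)))⁻¹ * εE * Real.exp (-(δ * tdistT M y y')))) :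
    HasMaj (BlockNorm.ofBlocks (unitTorusGeo L k M) (liftBlk (fun b : Tor (fine (L ^ k) M) × Fin (d + 1) => blockOf (L ^ k) M b.1) ι)) (BlockNorm.ofBlocks (unitTorusGeo L k M) (liftBlk (fun y : Tor M => y) ι)) (idef (pull (liftMap (kingPrV L k m M) ι)) (LinearMap.id : (Tor M × ι → ℝ) →ₗ[ℝ] (Tor M × ι → ℝ)) (Matrix.mulVecLin ((cE M (L ^ m * L ^ k) T' a'))ᵀ) (Matrix.mulVecLin ((cE M (L ^ k) T a))ᵀ)) (fun y y' => (((d : ℝ) + 1) * Fintype.card ι * εE) * Real.exp (-(δ * tdistT M y y'))) := by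
  have hκV1 : (BlockNorm.ofBlocks (unitTorusGeo L k M) (liftBlk (fun b : Tor (fine (L ^ m * L ^ k) M) × Fin (d + 1) => blockOf (L ^ m * L ^ k) M b.1) ι)).κ = 1 := kappa_ofBlocks _
  have hNU : ((((L ^ m) ^ (d + 1) : ℕ) : ℝ)) ≠ 0 := Nat.cast_ne_zero.mpr (pow_ne_zero _ (pow_ne_zero _ (NeZero.ne L)))
  have hν : ∀ q : (Tor (fine (L ^ k) M) × Fin (d + 1)) × ι, (fibre (liftMap (kingPrV L k m M) ι) q).card = (L ^ m) ^ (d + 1) := fun q => card_fibre_kingPrV_lift L k m M ι q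
  rw [← mulVecLin_dE] at hDE
  have hT := hasMaj_mulVecLin_transpose (g := unitTorusGeo L k M) (liftBlk (fun y : Tor M => y) ι) (liftBlk (fun b : Tor (fine (L ^ m * L ^ k) M) × Fin (d + 1) => blockOf (L ^ m * L ^ k) M b.1) ι) (K := fun y y' => (((((L ^ k : ℕ) : ℝ)) ^ (d + 1)))⁻¹ * εE * Real.exp (-(δ * tdistT M y y')))
    (N := (d + 1) * (L ^ m * L ^ k) ^ (d + 1) * Fintype.card ι) (fun y y' => by positivity) (fun z => (card_fibre_blkV M (L ^ m * L ^ k) ι z).le) hDE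
  have hTP := hasMaj_comp_localRight hT (hasMaj_pull_kingPrV_lift M L k m (ι := ι)) fun y y' => by positivity
  have h := hasMaj_smul_ofBlocks (g := unitTorusGeo L k M) (liftBlk (fun y : Tor M => y) ι) (K := fun y y' => ((((d + 1) * (L ^ m * L ^ k) ^ (d + 1) * Fintype.card ι : ℕ) : ℝ)) * ((((((L ^ k : ℕ) : ℝ)) ^ (d + 1)))⁻¹ * εE * Real.exp (-(δ * tdistT M y' y))) * ((BlockNorm.ofBlocks (unitTorusGeo L k M) (liftBlk (fun b : Tor (fine (L ^ m * L ^ k) M) × Fin (d + 1) => blockOf (L ^ m * L ^ k) M b.1) ι)).κ * 1))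
    (fun y y' => mul_nonneg (mul_nonneg (Nat.cast_nonneg _) (by positivity)) (mul_nonneg (BlockNorm.κ_nonneg _) zero_le_one)) (((((L ^ m) ^ (d + 1) : ℕ) : ℝ)))⁻¹ hTP
  rw [← mulVecLin_dEt, show ((cE M (L ^ m * L ^ k) T' a'))ᵀ * (pullMat (liftMap (kingPrV L k m M) ι)) - ((cE M (L ^ k) T a))ᵀ = (((((L ^ m) ^ (d + 1) : ℕ) : ℝ)))⁻¹ • (((((((L ^ m) ^ (d + 1) : ℕ) : ℝ)) • (cE M (L ^ m * L ^ k) T' a') - (pullMat (liftMap (kingPrV L k m M) ι)) * (cE M (L ^ k) T a)))ᵀ * (pullMat (liftMap (kingPrV L k m M) ι))) by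
    rw [transpose_idef_mul_pullMat _ hν, smul_smul, inv_mul_cancel₀ hNU, one_smul], mulVecLin_smul', Matrix.mulVecLin_mul, mulVecLin_pullMat]
  refine h.mono fun y y' => le_of_eq ?_
  rw [hκV1, tdistT_symm M y' y, abs_of_nonneg (inv_nonneg.mpr (by positivity : (0 : ℝ) ≤ ((((L ^ m) ^ (d + 1) : ℕ) : ℝ))))]
  have hL : (L : ℝ) ≠ 0 := Nat.cast_ne_zero.mpr (NeZero.ne L)
  push_cast
  field_simp
  ring

end Transposed

end Summit.QuantumFields.YangMills.BalabanUVNodes.N15.CovLandau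

end
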